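import Mathlib
import HarnessLib
import HarnessLib.Audit
import Summits.AtomisticToContinuum.Statement
import Literature.MathematicalPhysics.KineticTheory.InfiniteChainDynamics
import Literature.MathematicalPhysics.KineticTheory.InfiniteChainInvariantStates
import Literature.MathematicalPhysics.KineticTheory.LangevinChainNESS
import Literature.MathematicalPhysics.KineticTheory.LangevinChainNESSHolds
import Summits.AtomisticToContinuum.FouriersLaw.Theorems.EmbeddedDrudeMourreNessUnique
import Summits.AtomisticToContinuum.FouriersLaw.Theorems.FourierGreenKuboFourierFiniteResponseOfUnique
import HarnessLib.Audit.Status.Attr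

/-!
Route: TangentFlowDephasing

DORMANT since 2026-08-22T09:21:06Z (reconciler: no traction for 5.2 d (last activity item-evidence-added at 2026-08-17T03:05:10Z); parked, not closed — `ledger route dormant route-AtomisticToContinuum-TangentFlowDephasing --off` to reac) — unstaffed, not closed; items shared with open routes are served there. `ledger route dormant <id> --off` reactivates.

# Route TangentFlowDephasing — Green–Kubo through the one-phonon L² lifetime — dephasing-limited
transport in the chain's own dynamic disorder

X (BULK SELF-DEPHASING; realises card tangent-flow-self-dephasing as a route that DECIDES the
conjunct — its gen-1 route SelfDephasing was
retired not-a-thesis only for want of a `closes` theorem): for pinnedChain ω₂ lam β γ (all four > 0)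
and every T > 0 there are a
TRANSLATION-INVARIANT DLR Gibbs state μ_T and a μ_T-preserving infinite-volume dynamics D with
absolutely convergent current correlations such
that (SD1) the ONE-PHONON BLOCK G_ab(x,t) := ∫ a_0·(b_x∘φ_t) dμ_T, a,b ∈ {q,p} — equal, by Gaussian
integration by parts in p_0, to T × the
Gibbs-AVERAGED TANGENT FLOW ∂(q_x,p_x)(t)/∂p_0 (the card's "linear response = averaged tangent
flow") — is square-integrable over ℤ × (0,∞)
(finite L² phonon lifetime τ₂(T) in the dynamic disorder ω₂ + 3·lam·q_x(t)², 1 + 3β·r_b(t)² the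
chain generates itself), AND Green–Kubo
holds for (D, μ_T) (C_T ∈ L¹(0,∞), κ_GK(T) > 0). X is reached from three own cruxes —
OnePhononL2Decay (SD1, the dephasing input, ∃-witness),
LifetimeControlsCurrent (SD2: L² lifetime ⇒ C_T ∈ L¹, dephasing-LIMITED transport) and
NoSelfLocalization (SD3: C_T ∈ L¹ ⇒ κ_GK > 0, dynamic
self-disorder does not localise) — and, with the shared frame NessUnique (0741),
FiniteResponseOfUnique (0717), ThermodynamicLimit (0742) and
the PROVED theorem pinnedChain_exists_isSteadyState, the deciding theorem `closes` concludes
`_root_.FouriersLaw` (glue.lean, lean check rc 0).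
Lean: `∀ ω₂ lam β γ : ℝ, 0 < ω₂ → 0 < lam → 0 < β → 0 < γ → ∀ T : ℝ, 0 < T → ∃ μ :
MeasureTheory.Measure Literature.MathematicalPhysics.KineticTheory.HeatConduction.ChainConfig,
(Literature.MathematicalPhysics.KineticTheory.HeatConduction.pinnedChain ω₂ lam β
γ).IsChainGibbsMeasure T μ ∧
Literature.MathematicalPhysics.KineticTheory.HeatConduction.IsShiftInvariant μ ∧ ∃ D :
Literature.MathematicalPhysics.KineticTheory.HeatConduction.InfiniteChainDynamics
(Literature.MathematicalPhysics.KineticTheory.HeatConduction.pinnedChain ω₂ lam β γ),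
D.PreservesMeasure μ ∧ ((∀ t : ℝ, D.HasAbsConvergentCorrelation μ t) ∧ (∀ (t : ℝ) (x : ℤ),
MeasureTheory.Integrable (fun σ => (σ 0).1 * (D.flow t σ x).1) μ ∧ MeasureTheory.Integrable (fun σ
=> (σ 0).1 * (D.flow t σ x).2) μ ∧ MeasureTheory.Integrable (fun σ => (σ 0).2 * (D.flow t σ x).1) μ
∧ MeasureTheory.Integrable (fun σ => (σ 0).2 * (D.flow t σ x).2) μ) ∧ (∀ x : ℤ,
MeasureTheory.IntegrableOn (fun t : ℝ => (MeasureTheory.integral μ (fun σ => (σ 0).1 * (D.flow t σ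
x).1)) ^ 2 + (MeasureTheory.integral μ (fun σ => (σ 0).1 * (D.flow t σ x).2)) ^ 2 +
(MeasureTheory.integral μ (fun σ => (σ 0).2 * (D.flow t σ x).1)) ^ 2 + (MeasureTheory.integral μ
(fun σ => (σ 0).2 * (D.flow t σ x).2)) ^ 2) (Set.Ioi 0) MeasureTheory.volume) ∧ Summable (fun x : ℤ
=> MeasureTheory.integral (MeasureTheory.volume.restrict (Set.Ioi (0:ℝ))) (fun t : ℝ =>
(MeasureTheory.integral μ (fun σ => (σ 0).1 * (D.flow t σ x).1)) ^ 2 + (MeasureTheory.integral μ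
(fun σ => (σ 0).1 * (D.flow t σ x).2)) ^ 2 + (MeasureTheory.integral μ (fun σ => (σ 0).2 * (D.flow t
σ x).1)) ^ 2 + (MeasureTheory.integral μ (fun σ => (σ 0).2 * (D.flow t σ x).2)) ^ 2))) ∧
D.HasGreenKubo μ T`

## Assembly
Pure logic, PROVED (Sketch.lean theorems `closes` and `assembly_proof`, lean check rc 0, axioms
propext / Classical.choice / Quot.sound):
OnePhononL2Decay supplies (μ_T, D) shift-invariant with absolutely convergent correlations and
finite L² lifetime; LifetimeControlsCurrent gives
C_T ∈ L¹; NoSelfLocalization gives κ_GK > 0, hence HasGreenKubo (the Target, and FourierGreenKubo's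
crux 0703 with a dephased witness);
clause (i) of FouriersLawFor from the PROVED theorem pinnedChain_exists_isSteadyState
(CuneoEckmannHairerReyBellet2018 Thm 2.13, all N) plus
NessUnique; clause (ii) with κ T := greenKuboConductivity of the ThermodynamicLimit witness
(Classical.choose; 1 for T ≤ 0), positivity by
HasGreenKubo.pos, D_N from FiniteResponseOfUnique and D_N → κ T from the witness clause of
ThermodynamicLimit. The deciding theorem is
`closes (h₁ : OnePhononL2Decay) (h₂ : LifetimeControlsCurrent) (h₃ : NoSelfLocalization) (hNU :
NessUnique) (hFR : FiniteResponseOfUnique)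
(hTL : ThermodynamicLimit) : _root_.FouriersLaw` (glue.lean).

Rationale: WHY THIS LINE. Mechanism (card tangent-flow-self-dephasing): a heat-carrying lattice wave sees the
anharmonic chain as a harmonic crystal with positive,
time-dependent stiffnesses — dynamic disorder generated by the chain itself — and in an EXOGENOUS
Markov medium such a wave dephases while its
intensity DIFFUSES with a positive-definite D(λ) = λ⁻²(D⁰ + O(λ)) for every coupling
(KangSchenker2009 Thm 1, arXiv:0808.2784 p. 6; Pillet1985;
white-noise limit D = 2J²/Γ, HakenStrobl1973; Markov noise even destroys Anderson localisation,
FrohlichSchenker2016; imposed dephasing makes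
harmonic lattices exactly Fourier, Znidaric2010, AsadianEtAl2013), and Γ ∝ (lam·T)² reproduces the
kinetic law κ ∝ (lam·T)⁻²
(AokiLukkarinenSpohn2006 §2 (2.7)–(2.11), §5) read as motional narrowing. Imported area: waves in
time-dependent random media and wave-kinetic
theory, with the explicit dictionary mean Green's function ⟨G⟩ ↦ one-phonon block G_ab = T⁻¹ ×
averaged tangent flow (SD1; its nearest theorem
is LukkarinenSpohn2010 Thm 2.4, e^{−Γ₁(k)|t|} damping of exactly this two-point function for the
lattice NLS in the kinetic limit), "no transport
channel outlives the dephasing time, D ≍ v²τ" ↦ SD2, "dynamic disorder never localises" ↦ SD3.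
Deliberately NOT claimed: a literal transfer of
Kang–Schenker (the symplectic tangent flow of a chaotic chain amplifies tangent INTENSITY at the
Lyapunov rate — only the signed Gibbs average
dephases — and the self-generated medium has no spectral gap, the conserved energy giving q_x² a
t^(−1/2) tail), so the card's surrogate-medium
sandwich (MediumTransfer) is replaced by intrinsic statements on equilibrium correlations of the
true chain, the Gaussian (Isserlis1918) part of
the current 4-point function being controlled by the one-phonon block by Cauchy–Schwarz and only
connected cumulants remaining (LukkarinenMarcozzi
doi:10.1063/1.4960556 for the cumulant-hierarchy technology). Versus the open routes:
FourierGreenKubo keeps GreenKubo (0703) monolithic — this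
route DECOMPOSES it into a flip-odd 2-point decay, a 2-point ⇒ 4-point domination and a positivity
statement with three different failure modes,
and is the bulk (infinite-volume) meeting point of the retired boundary lines TwoChannelDephasing /
PhononLifetime; KineticCorner and
DrudeMourre-type lines own the small-lam·T corner, where SD1 is their common target. Versus gen-1
SelfDephasing: translation invariance of μ_T is
now part of every statement (Parseval/Bochner structure; exotic non-shift-invariant DLR states
excluded) and the route carries its `closes`.

RANKED CRUXES. #0 SelfDephasedGreenKubo (target) — X as in § Thesis: for all ω₂, lam, β, γ > 0 and T
> 0 there are a shift-invariant DLR Gibbs state μ and a μ-preserving infinite-volume dynamics D with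
absolutely convergent current correlations at every time, μ-integrable one-phonon integrands
a_0·(b_x∘φ_t), finite one-phonon L² lifetime (for each x, t ↦ Σ_{a,b∈{q,p}} (∫ a_0·(b_x∘φ_t) dμ)²
integrable on (0,∞); these integrals summable over x ∈ ℤ) AND HasGreenKubo (C_T ∈ L¹(0,∞), κ_GK >
0). Forgetting shift-invariance and the lifetime gives FourierGreenKubo's crux 0703
(greenKubo_of_target, Sketch.lean). (why it might fail: Inherits SD1–SD3: no decay of any
equilibrium time-correlation is proved for a deterministic anharmonic lattice at fixed coupling, and
C_T ∉ L¹ (κ = ∞) by breather-trapped energy at strong pinning anharmonicity is conceivable even with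
dephased phonons.) [BonettoLebowitzReyBellet2000, LukkarinenSpohn2010, AokiLukkarinenSpohn2006,
KangSchenker2009]
#2 LifetimeControlsCurrent (crux) — SD2, DEPHASING-LIMITED TRANSPORT (card item MediumTransfer in
intrinsic form): for pinnedChain (all parameters > 0), T > 0, every SHIFT-INVARIANT DLR Gibbs state
μ and every μ-preserving dynamics D with absolutely convergent current correlations: if the
one-phonon block (∫ a_0·(b_x∘φ_t) dμ, a,b ∈ {q,p}; integrands integrable) is square-integrable over
ℤ × (0,∞), then t ↦ C_T(t) = currentCorrelation D μ t = Σ_x ∫ j_0·(j_x∘φ_t) dμ is integrable on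
(0,∞). Content: j_x = −½(p_x + p_{x+1})(r_x + βr_x³) is a polynomial of degree ≤ 4 in the flip-odd
fields (p, r); the Gaussian-pairing (Isserlis) part of ⟨j_0 j_x(t)⟩ is a sum of products of ≥ 2
one-phonon functions and is in L¹(ℤ × (0,∞)) by Cauchy–Schwarz from the hypothesis; the claim is
that the connected 4-, 6-, 8-point cumulants of (p, r) are integrable too (their expected tail is
the diffusive mode-coupling t^(−3/2) of the conserved energy, integrable in d = 1) — "no transport
channel outlives the phonon by a non-integrable amount", the Haken–Strobl / Kang–Schenker step D ≍
v²τ. [difficulty: open-problem] (why it might fail: 2-point L² decay does not bound connected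
4/6/8-point cumulants: a quasi-conserved flip-even charge overlapping j (Mazur1969; slow phonon
number, HuveneersLukkarinen2020) or breather-trapped energy at strong pinning anharmonicity
(DeRoeckHuveneers2015) can leave C_T ∉ L¹ with τ₂ < ∞.) [KangSchenker2009, HakenStrobl1973,
Isserlis1918, doi:10.1063/1.4960556, Mazur1969, HuveneersLukkarinen2020, DeRoeckHuveneers2015,
AokiLukkarinenSpohn2006, Lukkarinen2016]
#3 OnePhononL2Decay (crux) — SD1, THE DEPHASING INPUT (card item SingleSiteDecorrelation, moved from
the site energy — which carries the conserved-energy t^(−1/2) tail — to the flip-odd one-phonon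
sector): for all parameters > 0 and T > 0 there exist a SHIFT-INVARIANT DLR Gibbs state μ and a
μ-preserving infinite-volume dynamics D (cf. InfiniteVolumeSetup, 0743) with absolutely convergent
current correlations at every time such that, for a,b ∈ {q,p}, the integrands a_0·(b_x∘φ_t) are
μ-integrable, t ↦ Σ_{a,b} (∫ a_0·(b_x∘φ_t) dμ)² is integrable on (0,∞) for each x ∈ ℤ, and these
integrals are summable over x: finite L² phonon lifetime τ₂(T) (Parseval: ∫_0^∞ ∫ |Ĝ(k,t)|² dk dt <
∞). By Gaussian integration by parts in p_0 these functions are T × the Gibbs-averaged tangent-flow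
matrix elements ∂(q_x,p_x)(t)/∂p_0 (and their time-antiderivatives): the AVERAGED linearised
dynamics dephases although ‖U_t‖ grows at the Lyapunov rate. Structural reason it is easier than
transport: (q,p) ↦ (−q,−p) is a symmetry of pinnedChain and of its Gibbs state, q and p are odd and
every functional of the energy field is even, so the block has no hydrodynamic projection at any
order; its nearest theorem is the kinetic-limit damping e^{−Γ₁(k)|t|} of the same covariance for the
lattice NLS (LukkarinenSpohn2010 Thm 2.4). [difficulty: open-problem] (why it might fail: False at
lam=β=0 (∫|Ĝ(k,t)|²dk does not decay: HarmonicChainBallisticFlux corner) and non-uniform as lam·T→0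
(τ₂~(lamT)⁻²); equilibrium time-correlation decay of an infinite anharmonic chain at fixed coupling
is open even qualitatively (LukkarinenSpohn2010 p.4); breathers may leave a tail.)
[LukkarinenSpohn2010, AokiLukkarinenSpohn2006, Lukkarinen2016, LanfordLebowitzLieb1977,
ButtaEtAl2007, LefevereSchenkel2006, HuveneersLukkarinen2020]
#4 NoSelfLocalization (crux) — SD3, DYNAMIC SELF-DISORDER DOES NOT LOCALISE: for all parameters > 0,
T > 0, every SHIFT-INVARIANT DLR Gibbs state μ and μ-preserving dynamics D with absolutely
convergent current correlations: C_T ∈ L¹(0,∞) ⇒ κ_GK = greenKuboConductivity D μ T = T⁻² ∫_0^∞ C_T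
> 0. For a space-time stationary current process C_T is even and positive-definite, so ∫_0^∞ C_T =
½Ĉ_T(0) ≥ 0 (Bochner; this is where translation invariance of μ is used); the content is STRICT
positivity — the energy current of the pinned chain is not asymptotically a time-derivative (no
vanishing Drude–Green–Kubo weight at zero frequency, no insulating phase): the intrinsic form of
"Markov dynamic disorder delocalises" (FrohlichSchenker2016), needed at every T, not only in the
kinetic corner. [difficulty: open-problem] (why it might fail: Asymptotic localisation
(DeRoeckHuveneers2015: conductivity below every power of the coupling in the strongly anharmonic
atomic limit) puts positivity beyond all orders there; delocalisation by dynamic disorder is a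
theorem only for EXOGENOUS Markov media with a spectral gap.) [FrohlichSchenker2016,
KangSchenker2009, DeRoeckHuveneers2015, BernardinHuveneers2013, Dhar2008,
BonettoLebowitzReyBellet2000]
#5 ThermodynamicLimit (crux) — identical signature to FourierGreenKubo.ThermodynamicLimit
(stmt-AtomisticToContinuum-0742; dedup intended): under weak-NESS uniqueness and T > 0, if some
Gibbs state with a μ_T-preserving Green–Kubo dynamics exists, such a witness (μ_T, D) can be fixed
before the steady-state family so that for every steady-state family and every sequence of finite-N
response coefficients D_N one has D_N → greenKuboConductivity D μ_T T. This route claims NO new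
engine for it: the card's "N-uniformity inherited from the N-independence of the local dephasing
rate" is exactly this step, the shared residual of every bulk (infinite-volume) line. [deps:
OnePhononL2Decay, LifetimeControlsCurrent, NoSelfLocalization] [difficulty: open-problem] (why it
might fail: Needs N-uniform decay of equilibrium current correlations of the thermostatted chain +
o(1) boundary layers; the open-chain spectral gap closes like γ/N (BeckerMenegaki2022) and κ = κ_GK
is unproved even formally (BonettoLebowitzReyBellet2000 §7).) [BonettoLebowitzReyBellet2000,
Dhar2008, KunduDharNarayan2009, ReyBellet2003,
Literature.Barriers.AtomisticToContinuum.HasBoundedResponse,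
Literature.Barriers.AtomisticToContinuum.BeckerMenegaki2022_gapClosing]
#9 NessUnique (support) — identical signature to FourierGreenKubo.NessUnique
(stmt-AtomisticToContinuum-0741; dedup intended): uniqueness of the weak steady state (IsSteadyState
class) of pinnedChain for all N, T_L, T_R > 0; with the proved existence theorem
pinnedChain_exists_isSteadyState it is clause (i) of FouriersLawFor and the hypothesis of
FiniteResponseOfUnique / ThermodynamicLimit. [difficulty: M] [CuneoEckmannHairerReyBellet2018,
Carmona2007]
#9 FiniteResponseOfUnique (support) — identical signature to
FourierGreenKubo.FourierFiniteResponseOfUnique (stmt-AtomisticToContinuum-0717; dedup intended):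
under weak-NESS uniqueness the finite-N linear-response limit D_N(T) = lim_{δ→0,δ≠0} totalCurrent(μ
N (T+δ/2) (T−δ/2))/δ exists for every steady-state family, T > 0 and N (Hairer–Majda / finite-volume
Kubo formula). [difficulty: L] [ReyBellet2003, HairerMajda2009]
#9 InfiniteVolumeSetup (support) — identical signature to FourierGreenKubo.InfiniteVolumeSetup
(stmt-AtomisticToContinuum-0743; dedup intended): for all parameters > 0 and T > 0 a DLR Gibbs state
of the pinned chain and a μ_T-preserving infinite-volume dynamics exist (transfer operator /
superstability; LanfordLebowitzLieb1977 Thm 3–4, ButtaEtAl2007-type locality) — the carrier on which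
OnePhononL2Decay is stated (SD1 additionally wants the witness shift-invariant, automatic for the
limit of periodic-box Gibbs states). [difficulty: L] [LanfordLebowitzLieb1977, ButtaEtAl2007]

TWO-LAYER PLAN. Foreseen glued splits (none filed now; k ≤ 3, depth 1): OnePhononL2Decay ⇐
KineticCornerDecay (τ₂ < ∞ for T ≤ T₀(ω₂,lam,β) from the
one-phonon golden rule / Mourre estimate on the flip-odd one-particle sector,
LukkarinenSpohn2010-type expansion at fixed small lam·T; shares
technology with card phonon-lifetime-one-particle-sector and route KineticCorner) →
DecayContinuation (propagation in T along the scaling ray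
(lamT, βT)) → OnePhononL2Decay. LifetimeControlsCurrent ⇐ GaussianPart (the Isserlis pairing terms
of ⟨j_0 j_x(t)⟩ are in L¹ from the hypothesis
by Cauchy–Schwarz: provable-now glue once the pairing is written out) → CumulantDomination
(connected 4/6/8-point parts ∈ L¹, cumulant
hierarchy à la Lukkarinen–Marcozzi) → LifetimeControlsCurrent. NoSelfLocalization ⇐
SpectralDensityForm (κ_GK = ½T⁻²Ĉ_T(0) via Bochner for
shift-invariant μ) → NonCoboundary (Ĉ_T(0) > 0: the current is not an H₋₁-coboundary of the
Liouvillian) → NoSelfLocalization.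

KILL CRITERIA. (a) ¬OnePhononL2Decay at some admissible (lam, β, T) — a coherent one-phonon mode
surviving in the anharmonic chain at positive temperature —
closes the route (`refuted:OnePhononL2Decay`) and wounds every dephasing card
(two-channel-dephasing, phonon-lifetime-one-particle-sector)
equally. (b) ¬LifetimeControlsCurrent (C_T ∉ L¹ although τ₂ < ∞: an incoherent channel with a
non-integrable tail, e.g. breather-trapped
energy) kills the dephasing-limited THESIS; together with ThermodynamicLimit it would give κ = ∞,
i.e. ¬FouriersLaw — file it. (c)
¬NoSelfLocalization = an insulating pinned anharmonic chain at some T ⇒ ¬FouriersLaw likewise. (d)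
Quantitative signature (numerics, recorded
here, not an item): the Haken–Strobl law κ(T) ≍ ⟨V″(r_0)⟩_T · τ₂(T) with T-INDEPENDENT constants is
scaling-consistent in both corners
((lamT)⁻² on both sides as T → 0; T^(1/4) = T^(1/2)·T^(−1/4) in the quartic corner T → ∞);
equilibrium-MD values of τ₂ against NEMD/literature
κ at T ∈ {0.2, 1, 5, 25} drifting like a power of T retire the "one engine across regimes" claim and
demote SD2 to a kinetic-corner statement.
(e) GreenKubo (0703) proved monolithically elsewhere moots SD2–SD3 but leaves SD1 as this route's
theorem; ThermodynamicLimit refuted kills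
every bulk line at once (pivot to boundary objects = the two-channel / conductance cards).

NOT DECOMPOSED YET. The engine for SD1 (one-phonon FGR/Mourre at small lam·T versus inhomogeneous
dephasing at large; any rate or exponential-in-x form — only
L² is filed); the cumulant bookkeeping of SD2 (which connected functions of (p, r), which mixed
norms; the pairing lemma); the Bochner/spectral
reformulation of SD3; T-continuity of κ; the EXOGENOUS rung (Kang–Schenker diffusion ⇒ BLR
conductivity for a number-conserving
Markov-modulated harmonic/RWA chain between two reservoirs — a theorem target of independent
interest that needs a new model structure;
deliberately not requested: it calibrates the dictionary but is not load-bearing for pinnedChain and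
would be an analogue hypothesis in
`closes`); the Gaussian-integration-by-parts identity G_pb = T·⟨∂(b_x∘φ_t)/∂p_0⟩ (needs
differentiability of the infinite-volume flow in the
initial datum, not a field of InfiniteChainDynamics); everything at finite N (owned by the boundary
cards / FeketeResistance-type lines).

CHEAPEST FALSIFIER. Equilibrium MD of the closed pinned chain (periodic, N = 512, (ω₂, lam, β) = (1,
1, 1), T = 1 then T = 5): accumulate
S(t_max) = Σ_x ∫_0^{t_max} Σ_{ab} G_ab(x,t)² dt and I(t_max) = ∫_0^{t_max} C_T; SD1 says S
saturates, SD2 says I saturates on a time scale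
comparable to τ₂ (up to an integrable t^(−3/2) tail); an incoherent tail saturating much later with
a ratio of saturation times growing with T
falsifies the dephasing-limited picture at once, and a non-saturating S falsifies SD1. Not run in
this unit (plancard, no kit budget). Analytic
checks done: harmonic corner (τ₂ = ∞, SD1 false as it must be), kinetic corner (both sides ∝
(lamT)⁻²), quartic corner (exponents match),
flip-parity (no hydrodynamic projection of the one-phonon block), negatives index (no FouriersLaw
statement refuted).

NUMBERS. Kinetic corner: κ(T)(lam·T)² → κ_kin for the pinned quartic chain, mean free path Λ ≅ 0.38
δ⁻²T⁻² (AokiLukkarinenSpohn2006 §2 (2.7)–(2.11),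
§5); Kang–Schenker: D(λ) = λ⁻²(D⁰ + O(λ)) positive definite (KangSchenker2009 Thm 1, arXiv:0808.2784
p. 6); Haken–Strobl: D = 2J²/Γ
(HakenStrobl1973); kinetic damping of the two-point function e^{−Γ₁(k)|t|} on the scale t = λ⁻²τ,
|τ| < t₀, d ≥ 4 (LukkarinenSpohn2010 Thm 2.4,
arXiv:0901.3283 p. 9). High-T (pure quartic) scaling of pinnedChain: κ ∝ T^(1/4), τ₂ ∝ T^(−1/4),
⟨V″(r)⟩_T ∝ T^(1/2) (dimensional analysis of
H ↦ s⁴H). Items at open: 9 (own cruxes 3 + shared crux 0742, shared supports 0741/0717/0743, target,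
assembly).

DEFINITION REQUESTS. None. ChainConfig, InfiniteChainDynamics (flow, PreservesMeasure,
HasAbsConvergentCorrelation, currentCorrelation, greenKuboConductivity,
HasGreenKubo), IsChainGibbsMeasure live in
Literature.MathematicalPhysics.KineticTheory.InfiniteChainDynamics; IsShiftInvariant in
…InfiniteChainInvariantStates (fact-free vocabulary module); the finite-N frame (pinnedChain,
IsSteadyState, totalCurrent, FouriersLaw) in
…FouriersLaw, the proved existence theorem pinnedChain_exists_isSteadyState in
…LangevinChainNESSHolds; the one-phonon block is written inline.

Novelty: Searches (2026-08-15): `lit frontier AtomisticToContinuum --since 2021` (30 rows; none on dephasing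
or equilibrium correlation decay of the
chain — nearest CanestrariLiveraniOlla2026, arXiv:2310.13338, a different deterministic model); `lit
search --source crossref "dephasing
Fourier's law harmonic chain heat transport exact nonequilibrium steady state"` (7; Znidaric2010
doi:10.1088/1742-5468/2010/05/l05002);
`lit search --source crossref "decay of equilibrium time correlations anharmonic lattice dynamics
thermal conductivity phonon lifetime current
autocorrelation"` (12; materials-science relaxation-time practice, LaddMoranHoover1986
doi:10.1103/physrevb.34.5058, Turney et al.
doi:10.1103/physrevb.79.064301); `lit search --source crossref "Wick polynomials and time-evolution
of cumulants"` (doi:10.1063/1.4960556);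
`lit galaxy search --star pdf --mode bm25 "dephasing noise … Fourier law … phonon lifetime"` (15;
Dubi–DiVentra 2009 PRB 79 "Reconstructing
Fourier's law from disorder in quantum wires", Rebentrost et al. 2009 NJP "Environment-assisted
quantum transport", Michel et al.
cond-mat/0611612); three `lit galaxy search --star all` substring probes (0 hits); `lit read
arXiv:0901.3283` pp. 4, 9 (Thm 2.4), `lit read
arXiv:0808.2784` p. 6 (Thm 1), `lit read arXiv:cond-mat/0602082` pp. 3, 8; `lit search --hybrid`
(textbook hits only; local FTS leg and
searchd were intermittently unavailable this session — recorded, not worked around); the card's 13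
references, its refuter audi  [refs: 10.1088/1742-5468/2010/05/l05002, 10.1103/physrevb.34.5058, 10.1103/physrevb.79.064301, 10.1063/1.4960556, 2310.13338, 0901.3283, 0808.2784, cond-mat/0602082, doi:10.1088/1742-5468/2010/05/l05002, doi:10.1103/physrevb.34.5058, doi:10.1103/physrevb.79.064301, doi:10.1063/1.4960556, CanestrariLiveraniOlla2026, Znidaric2010, AsadianEtAl2013, Ruelle2009, HairerMajda2009, BernardinOlla2011, LukkarinenS]

Barriers (technique_class: self-dephasing one-phonon-lifetime cumulant-domination): - technique_class: self-dephasing one-phonon-lifetime cumulant-domination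
- Literature.Barriers.AtomisticToContinuum.HarmonicChainBallisticFlux: the lam = β = 0 corner is
exactly where SD1 is false (∫|Ĝ(k,t)|²dk does not decay in t); all statements are for lam, β > 0 at
fixed T and claim nothing uniformly in the anharmonicity.
- Literature.Barriers.AtomisticToContinuum.LowTemperatureWeakAnharmonicity: no T-uniformity is
claimed; τ₂ ~ κ ~ (lamT)⁻² is the predicted common divergence
(AokiLukkarinenSpohn2006_kineticLowTemperature_prediction), used as a consistency check, not
contradicted.
- Literature.Barriers.AtomisticToContinuum.Mazur1969_inequality: a conserved or quasi-conserved
charge overlapping j is precisely the recorded failure mode of LifetimeControlsCurrent (it lives in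
the connected 4-point part, invisible to the flip-odd one-phonon block); not evaded — kill criterion
(b); pinning removes the momentum charge, nothing else is assumed away.
- Literature.Barriers.AtomisticToContinuum.DeRoeckHuveneers2015_thm2: positivity (SD3) and cumulant
control (SD2) cannot come from an expansion in the coupling; they are filed non-perturbatively at
fixed parameters, conceding that the strongly-anharmonic-pinning corner is where both are hardest.
- Literature.Barriers.AtomisticToContinuum.HasBoundedResponse: every own crux is an infinite-volume
equilibrium statement; N-dependence is confined to the shared ThermodynamicLimit (0742), marked as
not attacked here — it does not evade the

History (route lifecycle, newest last):
- 2026-08-22T09:21:06Z · DORMANT — reconciler: no traction for 5.2 d (last activity item-evidence-added at 2026-08-17T03:05:10Z); parked, not closed — `ledger route dormant route-AtomisticToConti (operator:999:3989808)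

sub-problem: FouriersLaw · status: dormant · opened planner-plancard-AtomisticToContinuum-Fourier-a1ac1a18-g2-0 2026-08-15T18:50:26Z · rev 4 · ledger route-AtomisticToContinuum-TangentFlowDephasing
GENERATED by the gate from the ledger (D-0016/17). Provers cite these decls: `theorem foo : Summit.AtomisticToContinuum.FouriersLaw.Theses.TangentFlowDephasing.<Decl> := …` in Summits/AtomisticToContinuum/FouriersLaw/Theorems/<Name>.lean.
-/

namespace Summit.AtomisticToContinuum.FouriersLaw.Theses.TangentFlowDephasing

open scoped BigOperators Topology Manifold Classical MeasureTheory ProbabilityTheory Matrix InnerProductSpace ComplexConjugate ContinuousMap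
open Filter Set Function TopologicalSpace MeasureTheory

attribute [summit_statement] _root_.FouriersLaw

/-- item stmt-AtomisticToContinuum-12155 · target · rank 0 · open · by planner
why it might fail: Inherits SD1–SD3: no decay of any equilibrium time-correlation is proved for a deterministic anharmonic lattice at fixed coupling, and C_T ∉ L¹ (κ = ∞) by breather-trapped energy at strong pinning anharmonicity is conceivable even with dephased phonons.
sources: BonettoLebowitzReyBellet2000, LukkarinenSpohn2010, AokiLukkarinenSpohn2006, KangSchenker2009
[target] X as in § Thesis: for all ω₂, lam, β, γ > 0 and T > 0 there are a shift-invariant DLR Gibbs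
state μ and a μ-preserving infinite-volume dynamics D with absolutely convergent current
correlations at every time, μ-integrable one-phonon integrands a_0·(b_x∘φ_t), finite one-phonon L²
lifetime (for each x, t ↦ Σ_{a,b∈{q,p}} (∫ a_0·(b_x∘φ_t) dμ)² integrable on (0,∞); these integrals
summable over x ∈ ℤ) AND HasGreenKubo (C_T ∈ L¹(0,∞), κ_GK > 0). Forgetting shift-invariance and the
lifetime gives FourierGreenKubo's crux 0703 (greenKubo_of_target, Sketch.lean). -/
@[route_item "route-AtomisticToContinuum-TangentFlowDephasing"]
def SelfDephasedGreenKubo : Prop :=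
  ∀ ω₂ lam β γ : ℝ, 0 < ω₂ → 0 < lam → 0 < β → 0 < γ → ∀ T : ℝ, 0 < T → ∃ μ : MeasureTheory.Measure Literature.MathematicalPhysics.KineticTheory.HeatConduction.ChainConfig, (Literature.MathematicalPhysics.KineticTheory.HeatConduction.pinnedChain ω₂ lam β γ).IsChainGibbsMeasure T μ ∧ Literature.MathematicalPhysics.KineticTheory.HeatConduction.IsShiftInvariant μ ∧ ∃ D : Literature.MathematicalPhysics.KineticTheory.HeatConduction.InfiniteChainDynamics (Literature.MathematicalPhysics.KineticTheory.HeatConduction.pinnedChain ω₂ lam β γ), D.PreservesMeasure μ ∧ ((∀ t : ℝ, D.HasAbsConvergentCorrelation μ t) ∧ (∀ (t : ℝ) (x : ℤ), MeasureTheory.Integrable (fun σ => (σ 0).1 * (D.flow t σ x).1) μ ∧ MeasureTheory.Integrable (fun σ => (σ 0).1 * (D.flow t σ x).2) μ ∧ MeasureTheory.Integrable (fun σ => (σ 0).2 * (D.flow t σ x).1) μ ∧ MeasureTheory.Integrable (fun σ => (σ 0).2 * (D.flow t σ x).2) μ) ∧ (∀ x : ℤ, MeasureTheory.IntegrableOn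 (fun t : ℝ => (MeasureTheory.integral μ (fun σ => (σ 0).1 * (D.flow t σ x).1)) ^ 2 + (MeasureTheory.integral μ (fun σ => (σ 0).1 * (D.flow t σ x).2)) ^ 2 + (MeasureTheory.integral μ (fun σ => (σ 0).2 * (D.flow t σ x).1)) ^ 2 + (MeasureTheory.integral μ (fun σ => (σ 0).2 * (D.flow t σ x).2)) ^ 2) (Set.Ioi 0) MeasureTheory.volume) ∧ Summable (fun x : ℤ => MeasureTheory.integral (MeasureTheory.volume.restrict (Set.Ioi (0:ℝ))) (fun t : ℝ => (MeasureTheory.integral μ (fun σ => (σ 0).1 * (D.flow t σ x).1)) ^ 2 + (MeasureTheory.integral μ (fun σ => (σ 0).1 * (D.flow t σ x).2)) ^ 2 + (MeasureTheory.integral μ (fun σ => (σ 0).2 * (D.flow t σ x).1)) ^ 2 + (MeasureTheory.integral μ (fun σ => (σ 0).2 * (D.flow t σ x).2)) ^ 2))) ∧ D.HasGreenKubo μ T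

/-- item stmt-AtomisticToContinuum-12156 · crux · rank 2 · open · by planner
why it might fail: 2-point L² decay does not bound connected 4/6/8-point cumulants: a quasi-conserved flip-even charge overlapping j (Mazur1969; slow phonon number, HuveneersLukkarinen2020) or breather-trapped energy at strong pinning anharmonicity (DeRoeckHuveneers2015) can leave C_T ∉ L¹ with τ₂ < ∞.
sources: KangSchenker2009, HakenStrobl1973, Isserlis1918, doi:10.1063/1.4960556, Mazur1969, HuveneersLukkarinen2020
[crux] SD2, DEPHASING-LIMITED TRANSPORT (card item MediumTransfer in intrinsic form): for
pinnedChain (all parameters > 0), T > 0, every SHIFT-INVARIANT DLR Gibbs state μ and every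
μ-preserving dynamics D with absolutely convergent current correlations: if the one-phonon block (∫
a_0·(b_x∘φ_t) dμ, a,b ∈ {q,p}; integrands integrable) is square-integrable over ℤ × (0,∞), then t ↦
C_T(t) = currentCorrelation D μ t = Σ_x ∫ j_0·(j_x∘φ_t) dμ is integrable on (0,∞). Content: j_x =
−½(p_x + p_{x+1})(r_x + βr_x³) is a polynomial of degree ≤ 4 in the flip-odd fields (p, r); the
Gaussian-pairing (Isserlis) part of ⟨j_0 j_x(t)⟩ is a sum of products of ≥ 2 one-phonon functions
and is in L¹(ℤ × (0,∞)) by Cauchy–Schwarz from the hypothesis; the claim is that the connected 4-,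
6-, 8-point cumulants of (p, r) are integrable too (their expected tail is the diffusive
mode-coupling t^(−3/2) of the conserved energy, integrable in d = 1) — "no transport channel
outlives the phonon by a non-integrable amount", the Haken–Strobl / Kang–Schenker step D ≍ v²τ.
[difficulty: open-problem] -/
@[route_item "route-AtomisticToContinuum-TangentFlowDephasing", crux]
def LifetimeControlsCurrent : Prop :=
  ∀ ω₂ lam β γ : ℝ, 0 < ω₂ → 0 < lam → 0 < β → 0 < γ → ∀ T : ℝ, 0 < T → ∀ (μ : MeasureTheory.Measure Literature.MathematicalPhysics.KineticTheory.HeatConduction.ChainConfig) (D : Literature.MathematicalPhysics.KineticTheory.HeatConduction.InfiniteChainDynamics (Literature.MathematicalPhysics.KineticTheory.HeatConduction.pinnedChain ω₂ lam β γ)), (Literature.MathematicalPhysics.KineticTheory.HeatConduction.pinnedChain ω₂ lam β γ).IsChainGibbsMeasure T μ → Literature.MathematicalPhysics.KineticTheory.HeatConduction.IsShiftInvariant μ → D.PreservesMeasure μ → (∀ t : ℝ, D.HasAbsConvergentCorrelation μ t) → (∀ (t : ℝ) (x : ℤ), MeasureTheory.Integrable (fun σ => (σ 0).1 * (D.flow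 t σ x).1) μ ∧ MeasureTheory.Integrable (fun σ => (σ 0).1 * (D.flow t σ x).2) μ ∧ MeasureTheory.Integrable (fun σ => (σ 0).2 * (D.flow t σ x).1) μ ∧ MeasureTheory.Integrable (fun σ => (σ 0).2 * (D.flow t σ x).2) μ) ∧ (∀ x : ℤ, MeasureTheory.IntegrableOn (fun t : ℝ => (MeasureTheory.integral μ (fun σ => (σ 0).1 * (D.flow t σ x).1)) ^ 2 + (MeasureTheory.integral μ (fun σ => (σ 0).1 * (D.flow t σ x).2)) ^ 2 + (MeasureTheory.integral μ (fun σ => (σ 0).2 * (D.flow t σ x).1)) ^ 2 + (MeasureTheory.integral μ (fun σ => (σ 0).2 * (D.flow t σ x).2)) ^ 2) (Set.Ioi 0) MeasureTheory.volume) ∧ Summable (fun x : ℤ => MeasureTheory.integral (MeasureTheory.volume.restrict (Set.Ioi (0:ℝ))) (fun t : ℝ => (MeasureTheory.integral μ (fun σ => (σ 0).1 * (D.flow t σ x).1)) ^ 2 + (MeasureTheory.integral μ (fun σ => (σ 0).1 * (D.flow t σ x).2)) ^ 2 + (MeasureTheory.integral μ (fun σ => (σ 0).2 * (D.flow t σ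 x).1)) ^ 2 + (MeasureTheory.integral μ (fun σ => (σ 0).2 * (D.flow t σ x).2)) ^ 2)) → MeasureTheory.IntegrableOn (D.currentCorrelation μ) (Set.Ioi 0) MeasureTheory.volume

/-- item stmt-AtomisticToContinuum-12157 · crux · rank 3 · open · by planner
why it might fail: False at lam=β=0 (∫|Ĝ(k,t)|²dk does not decay: HarmonicChainBallisticFlux corner) and non-uniform as lam·T→0 (τ₂~(lamT)⁻²); equilibrium time-correlation decay of an infinite anharmonic chain at fixed coupling is open even qualitatively (LukkarinenSpohn2010 p.4); breathers may leave a tail.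
sources: LukkarinenSpohn2010, AokiLukkarinenSpohn2006, Lukkarinen2016, LanfordLebowitzLieb1977, ButtaEtAl2007, LefevereSchenkel2006
[crux] SD1, THE DEPHASING INPUT (card item SingleSiteDecorrelation, moved from the site energy —
which carries the conserved-energy t^(−1/2) tail — to the flip-odd one-phonon sector): for all
parameters > 0 and T > 0 there exist a SHIFT-INVARIANT DLR Gibbs state μ and a μ-preserving
infinite-volume dynamics D (cf. InfiniteVolumeSetup, 0743) with absolutely convergent current
correlations at every time such that, for a,b ∈ {q,p}, the integrands a_0·(b_x∘φ_t) are
μ-integrable, t ↦ Σ_{a,b} (∫ a_0·(b_x∘φ_t) dμ)² is integrable on (0,∞) for each x ∈ ℤ, and these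
integrals are summable over x: finite L² phonon lifetime τ₂(T) (Parseval: ∫_0^∞ ∫ |Ĝ(k,t)|² dk dt <
∞). By Gaussian integration by parts in p_0 these functions are T × the Gibbs-averaged tangent-flow
matrix elements ∂(q_x,p_x)(t)/∂p_0 (and their time-antiderivatives): the AVERAGED linearised
dynamics dephases although ‖U_t‖ grows at the Lyapunov rate. Structural reason it is easier than
transport: (q,p) ↦ (−q,−p) is a symmetry of pinnedChain and of its Gibbs state, q and p are odd and
every functional of the energy field is even, so the block has no hydrodynamic projection at any
order; its nearest theorem is the kinetic-limit da -/
@[route_item "route-AtomisticToContinuum-TangentFlowDephasing", crux]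
def OnePhononL2Decay : Prop :=
  ∀ ω₂ lam β γ : ℝ, 0 < ω₂ → 0 < lam → 0 < β → 0 < γ → ∀ T : ℝ, 0 < T → ∃ μ : MeasureTheory.Measure Literature.MathematicalPhysics.KineticTheory.HeatConduction.ChainConfig, (Literature.MathematicalPhysics.KineticTheory.HeatConduction.pinnedChain ω₂ lam β γ).IsChainGibbsMeasure T μ ∧ Literature.MathematicalPhysics.KineticTheory.HeatConduction.IsShiftInvariant μ ∧ ∃ D : Literature.MathematicalPhysics.KineticTheory.HeatConduction.InfiniteChainDynamics (Literature.MathematicalPhysics.KineticTheory.HeatConduction.pinnedChain ω₂ lam β γ), D.PreservesMeasure μ ∧ (∀ t : ℝ, D.HasAbsConvergentCorrelation μ t) ∧ (∀ (t : ℝ) (x : ℤ), MeasureTheory.Integrable (fun σ => (σ 0).1 * (D.flow t σ x).1) μ ∧ MeasureTheory.Integrable (fun σ => (σ 0).1 * (D.flow t σ x).2) μ ∧ MeasureTheory.Integrable (fun σ => (σ 0).2 * (D.flow t σ x).1) μ ∧ MeasureTheory.Integrable (fun σ => (σ 0).2 * (D.flow t σ x).2) μ) ∧ (∀ x : ℤ,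 MeasureTheory.IntegrableOn (fun t : ℝ => (MeasureTheory.integral μ (fun σ => (σ 0).1 * (D.flow t σ x).1)) ^ 2 + (MeasureTheory.integral μ (fun σ => (σ 0).1 * (D.flow t σ x).2)) ^ 2 + (MeasureTheory.integral μ (fun σ => (σ 0).2 * (D.flow t σ x).1)) ^ 2 + (MeasureTheory.integral μ (fun σ => (σ 0).2 * (D.flow t σ x).2)) ^ 2) (Set.Ioi 0) MeasureTheory.volume) ∧ Summable (fun x : ℤ => MeasureTheory.integral (MeasureTheory.volume.restrict (Set.Ioi (0:ℝ))) (fun t : ℝ => (MeasureTheory.integral μ (fun σ => (σ 0).1 * (D.flow t σ x).1)) ^ 2 + (MeasureTheory.integral μ (fun σ => (σ 0).1 * (D.flow t σ x).2)) ^ 2 + (MeasureTheory.integral μ (fun σ => (σ 0).2 * (D.flow t σ x).1)) ^ 2 + (MeasureTheory.integral μ (fun σ => (σ 0).2 * (D.flow t σ x).2)) ^ 2))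

/-- item stmt-AtomisticToContinuum-12158 · crux · rank 4 · open · by planner
why it might fail: Asymptotic localisation (DeRoeckHuveneers2015: conductivity below every power of the coupling in the strongly anharmonic atomic limit) puts positivity beyond all orders there; delocalisation by dynamic disorder is a theorem only for EXOGENOUS Markov media with a spectral gap.
sources: FrohlichSchenker2016, KangSchenker2009, DeRoeckHuveneers2015, BernardinHuveneers2013, Dhar2008, BonettoLebowitzReyBellet2000
[crux] SD3, DYNAMIC SELF-DISORDER DOES NOT LOCALISE: for all parameters > 0, T > 0, every
SHIFT-INVARIANT DLR Gibbs state μ and μ-preserving dynamics D with absolutely convergent current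
correlations: C_T ∈ L¹(0,∞) ⇒ κ_GK = greenKuboConductivity D μ T = T⁻² ∫_0^∞ C_T > 0. For a
space-time stationary current process C_T is even and positive-definite, so ∫_0^∞ C_T = ½Ĉ_T(0) ≥ 0
(Bochner; this is where translation invariance of μ is used); the content is STRICT positivity — the
energy current of the pinned chain is not asymptotically a time-derivative (no vanishing
Drude–Green–Kubo weight at zero frequency, no insulating phase): the intrinsic form of "Markov
dynamic disorder delocalises" (FrohlichSchenker2016), needed at every T, not only in the kinetic
corner. [difficulty: open-problem] -/
@[route_item "route-AtomisticToContinuum-TangentFlowDephasing", crux]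
def NoSelfLocalization : Prop :=
  ∀ ω₂ lam β γ : ℝ, 0 < ω₂ → 0 < lam → 0 < β → 0 < γ → ∀ T : ℝ, 0 < T → ∀ (μ : MeasureTheory.Measure Literature.MathematicalPhysics.KineticTheory.HeatConduction.ChainConfig) (D : Literature.MathematicalPhysics.KineticTheory.HeatConduction.InfiniteChainDynamics (Literature.MathematicalPhysics.KineticTheory.HeatConduction.pinnedChain ω₂ lam β γ)), (Literature.MathematicalPhysics.KineticTheory.HeatConduction.pinnedChain ω₂ lam β γ).IsChainGibbsMeasure T μ → Literature.MathematicalPhysics.KineticTheory.HeatConduction.IsShiftInvariant μ → D.PreservesMeasure μ → (∀ t : ℝ, D.HasAbsConvergentCorrelation μ t) → MeasureTheory.IntegrableOn (D.currentCorrelation μ) (Set.Ioi 0) MeasureTheory.volume → 0 < D.greenKuboConductivity μ T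

/-- item stmt-AtomisticToContinuum-0742 · crux · rank 5 · open · by planner
why it might fail: Needs N-uniform decay of equilibrium current correlations of the thermostatted chain + o(1) boundary layers; the open-chain spectral gap closes like γ/N (BeckerMenegaki2022) and κ = κ_GK is unproved even formally (BonettoLebowitzReyBellet2000 §7).
sources: BonettoLebowitzReyBellet2000, Dhar2008, KunduDharNarayan2009, ReyBellet2003, Literature.Barriers.AtomisticToContinuum.HasBoundedResponse, Literature.Barriers.AtomisticToContinuum.BeckerMenegaki2022_gapClosing
[crux] THERMODYNAMIC LIMIT OF THE RESPONSE COEFFICIENT, WITNESS FORM (supersedes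
stmt-AtomisticToContinuum-0704; refuters g12-0/1/2/3/5: the ∀(μ_T,D) form hid the claim that κ_GK is
the same for every DLR state and every dynamics). Under weak-NESS uniqueness and T > 0, IF some
Gibbs state with a μ_T-preserving Green–Kubo dynamics exists (hypothesis = GreenKubo at T), THEN
there is such a pair (μ_T, D), fixed before the steady-state family is chosen, such that for every
steady-state family μ and every sequence Dn of finite-volume response coefficients (Dn N =
lim_{δ→0,δ≠0} totalCurrent(μ N (T+δ/2) (T−δ/2))/δ, existence = FiniteResponse, uniqueness of limits
makes Dn canonical) one has Dn → greenKuboConductivity D μ_T T. Content: finite-volume Kubo formula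
(ReyBellet2003 Rem 4.4 (56)) + N-uniform decay of equilibrium current correlations of the Langevin
chain + o(1) boundary layers at the baths; open (BonettoLebowitzReyBellet2000 §7 after (37)). N = 0,
1: Dn = 0, irrelevant to atTop. -/
@[route_item "route-AtomisticToContinuum-TangentFlowDephasing", crux]
def ThermodynamicLimit : Prop :=
  ∀ ω₂ lam β γ : ℝ, 0 < ω₂ → 0 < lam → 0 < β → 0 < γ → (∀ (N : ℕ) (T_L T_R : ℝ), 0 < T_L → 0 < T_R → ∀ μ ν : MeasureTheory.Measure (Literature.MathematicalPhysics.KineticTheory.HeatConduction.PhaseSpace N), (Literature.MathematicalPhysics.KineticTheory.HeatConduction.pinnedChain ω₂ lam β γ).IsSteadyState N T_L T_R μ → (Literature.MathematicalPhysics.KineticTheory.HeatConduction.pinnedChain ω₂ lam β γ).IsSteadyState N T_L T_R ν → μ = ν) → ∀ T : ℝ, 0 < T → (∃ μT : MeasureTheory.Measure Literature.MathematicalPhysics.KineticTheory.HeatConduction.ChainConfig, (Literature.MathematicalPhysics.KineticTheory.HeatConduction.pinnedChain ω₂ lam β γ).IsChainGibbsMeasure T μT ∧ ∃ D : Literature.MathematicalPhysics.KineticTheory.HeatConduction.InfiniteChainDynamics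 (Literature.MathematicalPhysics.KineticTheory.HeatConduction.pinnedChain ω₂ lam β γ), D.PreservesMeasure μT ∧ D.HasGreenKubo μT T) → ∃ (μT : MeasureTheory.Measure Literature.MathematicalPhysics.KineticTheory.HeatConduction.ChainConfig) (D : Literature.MathematicalPhysics.KineticTheory.HeatConduction.InfiniteChainDynamics (Literature.MathematicalPhysics.KineticTheory.HeatConduction.pinnedChain ω₂ lam β γ)), (Literature.MathematicalPhysics.KineticTheory.HeatConduction.pinnedChain ω₂ lam β γ).IsChainGibbsMeasure T μT ∧ D.PreservesMeasure μT ∧ D.HasGreenKubo μT T ∧ ∀ μ : (N : ℕ) → ℝ → ℝ → MeasureTheory.Measure (Literature.MathematicalPhysics.KineticTheory.HeatConduction.PhaseSpace N), (∀ (N : ℕ) (T_L T_R : ℝ), 0 < T_L → 0 < T_R → (Literature.MathematicalPhysics.KineticTheory.HeatConduction.pinnedChain ω₂ lam β γ).IsSteadyState N T_L T_R (μ N T_L T_R)) → ∀ Dn : ℕ → ℝ, (∀ N : ℕ, Filter.Tendsto (fun δ : ℝ => (Literature.MathematicalPhysics.KineticTheory.HeatConduction.pinnedChain ω₂ lam β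 γ).totalCurrent (μ N (T + δ / 2) (T - δ / 2)) / δ) (nhdsWithin 0 {(0 : ℝ)}ᶜ) (nhds (Dn N))) → Filter.Tendsto Dn Filter.atTop (nhds (D.greenKuboConductivity μT T))

/-- item stmt-AtomisticToContinuum-0717 · support · rank 9 · closed · proved by Summit.AtomisticToContinuum.FouriersLaw.Theorems.FourierGreenKubo.finiteResponseOfUnique_holds (prover) · by planner
sources: ReyBellet2003, HairerMajda2009
CONDITIONAL FORM OF 0705 (supersedes it as the prover target; refuters pool-5/g3-0: 0705 stand-alone
quantifies over EVERY steady-state family and is false-prone if weak steady states were non-unique):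
assuming UNIQUENESS of weak steady states (IsSteadyState class) for pinnedChain at all N, T_L, T_R >
0, the finite-N linear-response limit D_N(T) = lim_{δ→0, δ≠0} totalCurrent(μ_{N,T+δ/2,T−δ/2})/δ
exists for every T > 0 and N. Content: differentiability at equilibrium of NESS expectations of the
polynomial currents in the bath temperatures (ReyBellet2003 arXiv:math-ph/0303021 Rem 4.4 (51)–(56)
finite-volume Green–Kubo; HairerMajda2009 arXiv:0909.4313 Thm 2.3 framework — their SDE Thm 4.4
Assumption 5 fails here, so verify Assumptions 1–3 via CEHR2018 (2.5)/Carmona2007 Thm 1.1(iv)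
weighted spectral gap). N = 0, 1: totalCurrent ≡ 0, D = 0. Together with 0706 gives 0705. -/
@[route_item "route-AtomisticToContinuum-TangentFlowDephasing", crux]
def FiniteResponseOfUnique : Prop :=
  ∀ ω₂ lam β γ : ℝ, 0 < ω₂ → 0 < lam → 0 < β → 0 < γ → (∀ (N : ℕ) (T_L T_R : ℝ), 0 < T_L → 0 < T_R → ∀ μ ν : MeasureTheory.Measure (Literature.MathematicalPhysics.KineticTheory.HeatConduction.PhaseSpace N), (Literature.MathematicalPhysics.KineticTheory.HeatConduction.pinnedChain ω₂ lam β γ).IsSteadyState N T_L T_R μ → (Literature.MathematicalPhysics.KineticTheory.HeatConduction.pinnedChain ω₂ lam β γ).IsSteadyState N T_L T_R ν → μ = ν) → ∀ μ : (N : ℕ) → ℝ → ℝ → MeasureTheory.Measure (Literature.MathematicalPhysics.KineticTheory.HeatConduction.PhaseSpace N), (∀ (N : ℕ) (T_L T_R : ℝ), 0 < T_L → 0 < T_R → (Literature.MathematicalPhysics.KineticTheory.HeatConduction.pinnedChain ω₂ lam β γ).IsSteadyState N T_L T_R (μ N T_L T_R)) → ∀ T : ℝ, 0 < T → ∀ N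 : ℕ, ∃ D : ℝ, Filter.Tendsto (fun δ : ℝ => (Literature.MathematicalPhysics.KineticTheory.HeatConduction.pinnedChain ω₂ lam β γ).totalCurrent (μ N (T + δ / 2) (T - δ / 2)) / δ) (nhdsWithin 0 {(0 : ℝ)}ᶜ) (nhds D)

/-- `FiniteResponseOfUnique` holds: proved by `Summit.AtomisticToContinuum.FouriersLaw.Theorems.FourierGreenKubo.finiteResponseOfUnique_holds`. -/
theorem FiniteResponseOfUnique_holds : FiniteResponseOfUnique := _root_.Summit.AtomisticToContinuum.FouriersLaw.Theorems.FourierGreenKubo.finiteResponseOfUnique_holds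

/-- item stmt-AtomisticToContinuum-0741 · support · rank 9 · closed · proved by Summit.AtomisticToContinuum.FouriersLaw.Theorems.nessUnique_proof (prover) · by planner
sources: CuneoEckmannHairerReyBellet2018, Carmona2007
[crux] UNIQUENESS OF THE WEAK STEADY STATE (the half of stmt-0706 not covered by the landed fact
Literature.MathematicalPhysics.KineticTheory.HeatConduction.CuneoEckmannHairerReyBellet2018_pinnedChain,
p3544): for pinnedChain ω₂ lam β γ (all > 0), every N and T_L, T_R > 0, any two measures in the weak
Fokker–Planck class IsSteadyState (probability, ∫ L f dμ = 0 for f ∈ C_c^∞, bond currents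
integrable) coincide. Print: uniqueness of the INVARIANT MEASURE of the Langevin semigroup
(CuneoEckmannHairerReyBellet2018 Thm 2.13(1): C1, C2, CA; Carmona2007 Thm 1.1(iii)); the item
additionally needs 'weak stationary probability solution of L*μ = 0 ⇒ P_t-invariant' for this
hypoelliptic L with cubic drift (Echeverría 1982 well-posed martingale problem on C_c^∞ +
non-explosion via e^{θH}; Bogachev–Krylov–Röckner–Shaposhnikov 2015 Ch. 5 is non-degenerate only) —
the FP-identification lemma is the formal crux. N = 0: PhaseSpace 0 is a point (unique probability
measure); N = 1: both baths on site 0, OU at temperature (T_L+T_R)/2. This is exactly the hypothesis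
of FiniteResponse and ThermodynamicLimit and, with the fact, gives clause (i) of FouriersLawFor. -/
@[route_item "route-AtomisticToContinuum-TangentFlowDephasing", crux]
def NessUnique : Prop :=
  ∀ ω₂ lam β γ : ℝ, 0 < ω₂ → 0 < lam → 0 < β → 0 < γ → ∀ (N : ℕ) (T_L T_R : ℝ), 0 < T_L → 0 < T_R → ∀ μ ν : MeasureTheory.Measure (Literature.MathematicalPhysics.KineticTheory.HeatConduction.PhaseSpace N), (Literature.MathematicalPhysics.KineticTheory.HeatConduction.pinnedChain ω₂ lam β γ).IsSteadyState N T_L T_R μ → (Literature.MathematicalPhysics.KineticTheory.HeatConduction.pinnedChain ω₂ lam β γ).IsSteadyState N T_L T_R ν → μ = ν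

/-- `NessUnique` holds: proved by `Summit.AtomisticToContinuum.FouriersLaw.Theorems.nessUnique_proof`. -/
theorem NessUnique_holds : NessUnique := _root_.Summit.AtomisticToContinuum.FouriersLaw.Theorems.nessUnique_proof

/-- item stmt-AtomisticToContinuum-0743 · support · rank 9 · closed · proved by Summit.AtomisticToContinuum.FouriersLaw.Theorems.InfiniteVolumeSetup.infiniteVolumeSetup_proof (prover) · by planner
sources: LanfordLebowitzLieb1977, ButtaEtAl2007
[support] INFINITE-VOLUME SET-UP, split off GreenKubo on refuters' advice (g12-1/3/4: hidden
infrastructure load): for pinnedChain (all parameters > 0) and T > 0 there is a DLR Gibbs state μ_T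
(IsChainGibbsMeasure: existence via the 1-D transfer operator e^{-U/2T}e^{-V(q′−q)/T}e^{-U/2T},
Hilbert–Schmidt since U ≥ ω₂q²/2, or superstability/tightness) and an InfiniteChainDynamics D with
D.PreservesMeasure μ_T (μ_T-a.e. carrier, every φ_t measurable and measure preserving; requires a
carrier on which solutions are UNIQUE — LanfordLebowitzLieb1977 Thm 3 gives a.e. existence only, Thm
1/A4 fails for quartic V, Thm 2/4 uniqueness and invariance of μ_T under the infinite flow are not
vendored; nearest print for quartic U+V: Buttà–Caglioti–Di Ruzza–Marchioro 2007
doi:10.1007/s10955-007-9278-0, Marchioro–Pellegrinotti–Pulvirenti 1981). Print-level known modulo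
assembling these; a prerequisite of any GreenKubo witness. -/
@[route_item "route-AtomisticToContinuum-TangentFlowDephasing"]
def InfiniteVolumeSetup : Prop :=
  ∀ ω₂ lam β γ : ℝ, 0 < ω₂ → 0 < lam → 0 < β → 0 < γ → ∀ T : ℝ, 0 < T → ∃ μ : MeasureTheory.Measure Literature.MathematicalPhysics.KineticTheory.HeatConduction.ChainConfig, (Literature.MathematicalPhysics.KineticTheory.HeatConduction.pinnedChain ω₂ lam β γ).IsChainGibbsMeasure T μ ∧ ∃ D : Literature.MathematicalPhysics.KineticTheory.HeatConduction.InfiniteChainDynamics (Literature.MathematicalPhysics.KineticTheory.HeatConduction.pinnedChain ω₂ lam β γ), D.PreservesMeasure μ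

/-- item stmt-AtomisticToContinuum-14118 · support · rank 9 · closed · proved by Summit.AtomisticToContinuum.FouriersLaw.Theorems.targetGlue_proof @ 4c5a6d2816cd (prover) · by planner
sources: BonettoLebowitzReyBellet2000
[support] GLUE OF THE TARGET (provable NOW; pure logic, 5 tactic lines; verified rc 0 with axioms
propext / Classical.choice / Quot.sound in the planner sketch, theorem targetGlueSketch_holds):
OnePhononL2Decay → LifetimeControlsCurrent → NoSelfLocalization → SelfDephasedGreenKubo. Proof: fix
ω₂, lam, β, γ > 0 and T > 0; OnePhononL2Decay gives (μ, D) with μ a SHIFT-INVARIANT DLR Gibbs state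
at T, D μ-preserving, absolutely convergent current correlations at every t, μ-integrable one-phonon
integrands a_0·(b_x∘φ_t), the L²-lifetime clause (IntegrableOn … (Ioi 0)) and the summability
clause; LifetimeControlsCurrent applied to THIS (μ, D) gives C_T = D.currentCorrelation μ ∈ L¹(Ioi
0); NoSelfLocalization then gives 0 < D.greenKuboConductivity μ T; and D.HasGreenKubo μ T is by
definition (∀ t, HasAbsConvergentCorrelation) ∧ IntegrableOn (currentCorrelation) (Ioi 0) ∧ 0 <
greenKuboConductivity
(Literature.MathematicalPhysics.KineticTheory.HeatConduction.InfiniteChainDynamics.HasGreenKubo), so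
the anonymous constructor ⟨μ, hG, hS, D, hP, ⟨hA, hI, hL, hSum⟩, hA, hC, hpos⟩ is the Target. Same
logic as the `hGKT` block inside the deciding theorem `closes`; filed as an item so that the Targe -/
@[route_item "route-AtomisticToContinuum-TangentFlowDephasing"]
def TargetGlue : Prop :=
  OnePhononL2Decay → LifetimeControlsCurrent → NoSelfLocalization → SelfDephasedGreenKubo

/-- item stmt-AtomisticToContinuum-12159 · assembly · rank 1 · closed · proved by Summit.AtomisticToContinuum.FouriersLaw.Theorems.tangentFlowDephasing_assembly_proof (prover) · by planner
sources: BonettoLebowitzReyBellet2000, CuneoEckmannHairerReyBellet2018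
[assembly] OnePhononL2Decay → LifetimeControlsCurrent → NoSelfLocalization → NessUnique →
FiniteResponseOfUnique → ThermodynamicLimit → FouriersLaw (the type of `closes`, curried). -/
@[route_item "route-AtomisticToContinuum-TangentFlowDephasing"]
def Assembly : Prop :=
  OnePhononL2Decay → LifetimeControlsCurrent → NoSelfLocalization → NessUnique → FiniteResponseOfUnique → ThermodynamicLimit → _root_.FouriersLaw

/-! D-0027 §2.1 — DECIDING THEOREM (planner-authored via `route open/edit --closes-file`; by planner-plancard-AtomisticToContinuum-Fourier-a1ac1a18-g2-0 2026-08-15T18:50:27Z):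
its hypotheses are this route's items and its conclusion the sub-problem Statement (glue_lint), and it elaborates with this file. -/

@[closes "route-AtomisticToContinuum-TangentFlowDephasing"] theorem closes (h1 : OnePhononL2Decay) (h2 : LifetimeControlsCurrent) (h3 : NoSelfLocalization)
    (hNU : NessUnique) (hFR : FiniteResponseOfUnique) (hTL : ThermodynamicLimit) :
    _root_.FouriersLaw := by
  intro ω₂ lam β γ hω hl hβ hγ
  have huniq := hNU ω₂ lam β γ hω hl hβ hγ
  refine ⟨?_, ?_⟩
  · -- clause (i): existence = the landed result pinnedChain_exists_isSteadyState, uniqueness = item NessUnique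
    intro N T_L T_R hL hR
    obtain ⟨μ, hμ⟩ :=
      Literature.MathematicalPhysics.KineticTheory.HeatConduction.pinnedChain_exists_isSteadyState hω hl hβ hγ N hL hR
    exact ⟨μ, hμ, fun ν hν => huniq N T_L T_R hL hR ν μ hν hμ⟩
  · -- clause (ii): SD1 witness → SD2 (C_T ∈ L¹) → SD3 (κ_GK > 0) = a Green–Kubo pair at every T > 0;
    -- ThermodynamicLimit fixes its witness pair (μ_T, D_T), κ T := greenKuboConductivity D_T μ_T T (1 for T ≤ 0),
    -- positivity by HasGreenKubo.pos, D_N from FiniteResponseOfUnique, D_N → κ T from the witness clause.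
    have hGKT : ∀ T : ℝ, 0 < T →
        ∃ μ : MeasureTheory.Measure Literature.MathematicalPhysics.KineticTheory.HeatConduction.ChainConfig,
          (Literature.MathematicalPhysics.KineticTheory.HeatConduction.pinnedChain ω₂ lam β γ).IsChainGibbsMeasure T μ ∧
          ∃ D : Literature.MathematicalPhysics.KineticTheory.HeatConduction.InfiniteChainDynamics
              (Literature.MathematicalPhysics.KineticTheory.HeatConduction.pinnedChain ω₂ lam β γ),
            D.PreservesMeasure μ ∧ D.HasGreenKubo μ T := by
      intro T hT
      obtain ⟨μ, hG, hS, D, hP, hA, hI, hL, hSum⟩ := h1 ω₂ lam β γ hω hl hβ hγ T hT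
      have hC := h2 ω₂ lam β γ hω hl hβ hγ T hT μ D hG hS hP hA ⟨hI, hL, hSum⟩
      have hpos := h3 ω₂ lam β γ hω hl hβ hγ T hT μ D hG hS hP hA hC
      exact ⟨μ, hG, D, hP, hA, hC, hpos⟩
    classical
    have hW := fun T (hT : 0 < T) => hTL ω₂ lam β γ hω hl hβ hγ huniq T hT (hGKT T hT)
    let μT := fun T (hT : 0 < T) => Classical.choose (hW T hT)
    have hμT := fun T (hT : 0 < T) => Classical.choose_spec (hW T hT)
    let DT := fun T (hT : 0 < T) => Classical.choose (hμT T hT)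
    have hDT := fun T (hT : 0 < T) => Classical.choose_spec (hμT T hT)
    refine ⟨fun T => if hT : 0 < T then (DT T hT).greenKuboConductivity (μT T hT) T else 1, ?_, ?_⟩
    · intro T hT
      simp only [dif_pos hT]
      exact (hDT T hT).2.2.1.pos
    · intro μ hμ T hT
      have hD := hFR ω₂ lam β γ hω hl hβ hγ huniq μ hμ T hT
      refine ⟨fun N => Classical.choose (hD N), fun N => Classical.choose_spec (hD N), ?_⟩
      simp only [dif_pos hT]
      exact (hDT T hT).2.2.2 μ hμ (fun N => Classical.choose (hD N)) (fun N => Classical.choose_spec (hD N))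

end Summit.AtomisticToContinuum.FouriersLaw.Theses.TangentFlowDephasing
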